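import Literature.Analysis.UnboundedOperators.HeatKernel
import Mathlib.MeasureTheory.Function.LpSpace.ContinuousCompMeasurePreserving
import HarnessLib

/-!
# Strong continuity of the heat semigroup on `Lᵖ` at `t = 0⁺` (discharge)

Sibling proof file of `HeatKernel.lean` (D-0014: named facts `def X : Prop` are discharged as
`theorem X_holds : X`). It discharges

* `Literature.tendsto_heatExtension_nhdsWithin_zero_holds : Literature.tendsto_heatExtension_nhdsWithin_zero` —
  for `f ∈ Lᵖ(E; F)`, `1 ≤ p < ∞` (`E` a finite-dimensional real inner product space with its
  Haar/Lebesgue `volume`, `F` a real Banach space), `‖e^{tΔ} f - f‖_p → 0` as `t → 0⁺`, where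
  `e^{tΔ} f = heatKernel t ⋆ f` is the Gauss–Weierstrass integral.

Source: E. M. Stein, *Singular Integrals and Differentiability Properties of Functions* (1970),
Ch. III §2.2, Theorem 2 (c): *let `φ ∈ L¹(ℝⁿ)`, `∫ φ = 1`, `φ_ε(x) = ε⁻ⁿ φ(x/ε)`; if `f ∈ Lᵖ(ℝⁿ)`,
`p < ∞`, then `‖f ⋆ φ_ε − f‖_p → 0` as `ε → 0`* (Stein remarks that part (c) only uses the
integrability and the normalisation of `φ`). The Gauss–Weierstrass kernels are the case
`φ = heatKernel 1`, `heatKernel t = φ_{√t}`. The printed proof: (1) `Δ(y) := ‖f(· − y) − f‖_p → 0`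
as `y → 0` (density of `C_c` in `Lᵖ`, `p < ∞`; "the continuity of the mapping `y ↦ f(x − y)` of
`ℝⁿ` to `Lᵖ(ℝⁿ)`"); (2) `f ⋆ φ_ε − f = ∫ [f(x − y) − f(x)] φ_ε(y) dy` because `∫ φ_ε = 1`;
(3) `‖f ⋆ φ_ε − f‖_p ≤ ∫ Δ(y) |φ_ε(y)| dy = ∫ Δ(εy) |φ(y)| dy → 0` by dominated convergence.

The Lean proof follows this architecture with two bookkeeping substitutions:

* step (1) is Mathlib's `MeasureTheory.Lp.compMeasurePreserving_continuous` (continuity of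
  `Lᵖ ∘ (measure-preserving continuous map)` in both arguments, `p < ∞`), applied to the
  translations `x ↦ x − y` (`Literature.Analysis.UnboundedOperators.tendsto_eLpNorm_comp_sub_right_sub`);
* in step (3) Minkowski's integral inequality is replaced by the Jensen–Tonelli bound
  `‖K ⋆ f − f‖_p^p ≤ ‖K‖₁^{p−1} ∫ |K(y)| Δ(y)^p dy` (`Literature.Analysis.UnboundedOperators.lintegral_rpow_enorm_convolution_sub_self_le`,
  the same Hölder step `Literature.Analysis.UnboundedOperators.lintegral_mul_rpow_le_of_one_le` used for Young's inequality in
  `HeatKernel.lean`), and the rescaling-plus-dominated-convergence argument by the explicit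
  Gaussian tail estimate `∫_{‖y‖ ≥ δ} heatKernel t ≤ 2^{n/2} e^{−δ²/(8t)}`
  (`Literature.Analysis.UnboundedOperators.setLIntegral_enorm_heatKernel_le`, from `heatKernel t ≤ 2^{n/2} e^{−δ²/(8t)} heatKernel (2t)`
  on `‖y‖ ≥ δ` and `∫ heatKernel (2t) = 1`), giving the concentration lemma
  `Literature.Analysis.UnboundedOperators.tendsto_lintegral_heatKernel_mul`.

The pointwise identity (2) holds at *every* `x` for the heat kernel, since `heatKernel t ∈ L^{p'}`
and `L^{p'} ⋆ Lᵖ` convolutions converge everywhere (`Literature.Analysis.UnboundedOperators.convolutionExistsAt_of_memLp`).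

## References

* E. M. Stein, *Singular Integrals and Differentiability Properties of Functions*, Princeton
  Mathematical Series 30, Princeton University Press (1970), Ch. III §2.2, Theorem 2 (c).
  [SteinSingularIntegrals1970]
* L. C. Evans, *Partial Differential Equations*, 2nd ed. (2010), §2.3.1, Theorem 1 (iii)
  (pointwise version for the heat kernel). [Evans2010]
-/

open MeasureTheory Filter Topology
open scoped Real ENNReal NNReal Convolution

noncomputable section

namespace Literature.Analysis.UnboundedOperators

/-! ### Strong continuity of `e^{tΔ}` on `L^p` at `t = 0⁺` -/

section TranslationContinuity

variable {G : Type*} [NormedAddCommGroup G] [MeasurableSpace G] [BorelSpace G]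
  {μ : Measure G} [μ.IsAddRightInvariant] [IsLocallyFiniteMeasure μ] [μ.InnerRegularCompactLTTop]
  {F : Type*} [NormedAddCommGroup F]

/-- Continuity of translation in `L^p`, `1 ≤ p < ∞`: `‖f(· - y) - f‖_p → 0` as `y → 0`
(the map `y ↦ f(· - y)` from `G` to `L^p(G)` is continuous). Stein, *Singular Integrals*,
Ch. III §2.2, proof of Theorem 2 (the function `Δ(y)`), via Mathlib's
`MeasureTheory.Lp.compMeasurePreserving_continuous`. [cite: SteinSingularIntegrals1970, Ch. III §2.2] -/
theorem tendsto_eLpNorm_comp_sub_right_sub {f : G → F} {p : ℝ≥0∞} (hf : MemLp f p μ)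
    (hp : 1 ≤ p) (hp' : p ≠ ∞) :
    Tendsto (fun y : G => eLpNorm (fun x => f (x - y) - f x) p μ) (𝓝 0) (𝓝 0) := by
  haveI : Fact (1 ≤ p) := ⟨hp⟩
  -- the translations, as a continuous family of continuous self-maps of `G`
  let T : C(G, C(G, G)) :=
    (ContinuousMap.mk (fun z : G × G => z.2 - z.1) (continuous_snd.sub continuous_fst)).curry
  have hT : ∀ y, MeasurePreserving (⇑(T y)) μ μ := fun y => measurePreserving_sub_right μ y
  have h := Filter.Tendsto.compMeasurePreservingLp (μ := μ) (ν := μ) (E := F) (p := p)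
    (tendsto_const_nhds : Tendsto (fun _ : G => hf.toLp f) (𝓝 (0 : G)) (𝓝 (hf.toLp f)))
    (T.continuous.tendsto 0) hT (hT 0) hp'
  rw [tendsto_iff_edist_tendsto_0] at h
  refine h.congr fun y => ?_
  rw [Lp.edist_def]
  refine eLpNorm_congr_ae ?_
  have hy : ((hf.toLp f : G → F) ∘ ⇑(T y)) =ᵐ[μ] (f ∘ ⇑(T y)) :=
    (hT y).quasiMeasurePreserving.ae_eq_comp hf.coeFn_toLp
  have h0 : ((hf.toLp f : G → F) ∘ ⇑(T 0)) =ᵐ[μ] (f ∘ ⇑(T 0)) :=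
    (hT 0).quasiMeasurePreserving.ae_eq_comp hf.coeFn_toLp
  filter_upwards [Lp.coeFn_compMeasurePreserving (hf.toLp f) (hT y),
    Lp.coeFn_compMeasurePreserving (hf.toLp f) (hT 0), hy, h0] with x hxy hx0 hxy' hx0'
  rw [Pi.sub_apply, hxy, hx0, hxy', hx0']
  simp [T]

end TranslationContinuity

section JensenTonelli

variable {G : Type*} [MeasurableSpace G] [AddGroup G] [MeasurableAdd₂ G] [MeasurableNeg G]
  {μ : Measure G} [SFinite μ] [μ.IsAddRightInvariant]
  {F : Type*} [NormedAddCommGroup F] [NormedSpace ℝ F] [CompleteSpace F]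

/-- Jensen–Tonelli bound for an approximation of the identity: if `K` is an integrable real
kernel of total mass `∫ K = 1` and the convolution `K ⋆ f` converges absolutely at a.e. point,
then for `1 ≤ p < ∞`
`∫ ‖(K ⋆ f)(x) - f(x)‖^p dx ≤ ‖K‖₁^{p-1} ∫ |K(y)| ‖f(· - y) - f‖_p^p dy`.
(This replaces Minkowski's integral inequality `‖K ⋆ f - f‖_p ≤ ∫ |K(y)| ‖f(· - y) - f‖_p dy`
in Stein's proof.) [folklore] -/
theorem lintegral_rpow_enorm_convolution_sub_self_le {K : G → ℝ} (hK : Integrable K μ)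
    (hK1 : ∫ y, K y ∂μ = 1) {f : G → F} (hf : AEStronglyMeasurable f μ)
    (hKf : ∀ᵐ x ∂μ, ConvolutionExistsAt K f x (ContinuousLinearMap.lsmul ℝ ℝ) μ)
    {p : ℝ} (hp : 1 ≤ p) :
    ∫⁻ x, ‖(K ⋆[ContinuousLinearMap.lsmul ℝ ℝ, μ] f) x - f x‖ₑ ^ p ∂μ ≤
      (∫⁻ y, ‖K y‖ₑ ∂μ) ^ (p - 1) * ∫⁻ y, ‖K y‖ₑ * ∫⁻ x, ‖f (x - y) - f x‖ₑ ^ p ∂μ ∂μ := by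
  have hp0 : 0 < p := one_pos.trans_le hp
  set A := ∫⁻ y, ‖K y‖ₑ ∂μ with hA
  have hKm : AEMeasurable (fun y => ‖K y‖ₑ) μ := hK.aestronglyMeasurable.enorm
  -- measurability of the integrands
  have hfm1 : ∀ x, AEMeasurable (fun y => ‖f (x - y) - f x‖ₑ) μ := fun x =>
    ((hf.comp_quasiMeasurePreserving
      (quasiMeasurePreserving_sub_left_of_right_invariant μ x)).sub
        aestronglyMeasurable_const).enorm
  have hfm2 : AEStronglyMeasurable (fun z : G × G => f (z.1 - z.2) - f z.1) (μ.prod μ) :=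
    (hf.comp_quasiMeasurePreserving (quasiMeasurePreserving_sub_of_right_invariant μ μ)).sub
      (hf.comp_quasiMeasurePreserving Measure.quasiMeasurePreserving_fst)
  have hfm3 : ∀ y, AEMeasurable (fun x => ‖f (x - y) - f x‖ₑ ^ p) μ := fun y =>
    ((hf.comp_quasiMeasurePreserving
      (measurePreserving_sub_right μ y).quasiMeasurePreserving).sub hf).enorm.pow_const _
  have hG : AEMeasurable (fun z : G × G => ‖K z.2‖ₑ * ‖f (z.1 - z.2) - f z.1‖ₑ ^ p) (μ.prod μ) :=
    hKm.comp_snd.mul (hfm2.enorm.pow_const _)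
  -- pointwise identity `(K ⋆ f) x - f x = ∫ K y • (f (x - y) - f x) dy` wherever `K ⋆ f` exists
  have hpt : ∀ᵐ x ∂μ, (K ⋆[ContinuousLinearMap.lsmul ℝ ℝ, μ] f) x - f x =
      ∫ y, K y • (f (x - y) - f x) ∂μ := by
    filter_upwards [hKf] with x hx
    have hx' : Integrable (fun y => K y • f (x - y)) μ := by
      simpa [ConvolutionExistsAt] using hx
    rw [convolution_def]
    simp only [ContinuousLinearMap.lsmul_apply, smul_sub]
    rw [integral_sub hx' (hK.smul_const (f x)), integral_smul_const, hK1, one_smul]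
  -- pointwise Jensen bound
  have hJ : ∀ᵐ x ∂μ, ‖(K ⋆[ContinuousLinearMap.lsmul ℝ ℝ, μ] f) x - f x‖ₑ ^ p ≤
      A ^ (p - 1) * ∫⁻ y, ‖K y‖ₑ * ‖f (x - y) - f x‖ₑ ^ p ∂μ := by
    filter_upwards [hpt] with x hx
    rw [hx]
    calc ‖∫ y, K y • (f (x - y) - f x) ∂μ‖ₑ ^ p
        ≤ (∫⁻ y, ‖K y‖ₑ * ‖f (x - y) - f x‖ₑ ∂μ) ^ p := by
          refine ENNReal.rpow_le_rpow ?_ hp0.le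
          refine (enorm_integral_le_lintegral_enorm _).trans_eq ?_
          simp_rw [enorm_smul]
      _ ≤ A ^ (p - 1) * ∫⁻ y, ‖K y‖ₑ * ‖f (x - y) - f x‖ₑ ^ p ∂μ :=
          lintegral_mul_rpow_le_of_one_le hKm (hfm1 x) hp
  calc ∫⁻ x, ‖(K ⋆[ContinuousLinearMap.lsmul ℝ ℝ, μ] f) x - f x‖ₑ ^ p ∂μ
      ≤ ∫⁻ x, A ^ (p - 1) * ∫⁻ y, ‖K y‖ₑ * ‖f (x - y) - f x‖ₑ ^ p ∂μ ∂μ := lintegral_mono_ae hJ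
    _ = A ^ (p - 1) * ∫⁻ y, ∫⁻ x, ‖K y‖ₑ * ‖f (x - y) - f x‖ₑ ^ p ∂μ ∂μ := by
        rw [lintegral_const_mul'' _ hG.lintegral_prod_right', lintegral_lintegral_swap hG]
    _ = A ^ (p - 1) * ∫⁻ y, ‖K y‖ₑ * ∫⁻ x, ‖f (x - y) - f x‖ₑ ^ p ∂μ ∂μ := by
        congr 1
        refine lintegral_congr fun y => ?_
        rw [lintegral_const_mul'' _ (hfm3 y)]

end JensenTonelli

section HeatTail

variable {E : Type*} [NormedAddCommGroup E] [InnerProductSpace ℝ E]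

/-- Gaussian tail comparison: for `0 < t`, `0 ≤ δ ≤ ‖y‖`,
`heatKernel t y ≤ 2^{n/2} exp(-δ²/(8t)) · heatKernel (2t) y`. [folklore] -/
theorem heatKernel_le_mul_heatKernel_two_mul {t δ : ℝ} (ht : 0 < t) (hδ : 0 ≤ δ) {y : E}
    (hy : δ ≤ ‖y‖) :
    heatKernel t y ≤ 2 ^ ((Module.finrank ℝ E : ℝ) / 2) * Real.exp (-δ ^ 2 / (8 * t)) *
      heatKernel (2 * t) y := by
  simp only [heatKernel]
  have h0 : (4 * π * (2 * t)) ^ (-(Module.finrank ℝ E : ℝ) / 2) =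
      (2 : ℝ) ^ (-(Module.finrank ℝ E : ℝ) / 2) * (4 * π * t) ^ (-(Module.finrank ℝ E : ℝ) / 2) := by
    rw [← Real.mul_rpow (x := 2) (y := 4 * π * t) (by norm_num) (by positivity)]
    congr 1
    ring
  have h1 : (4 * π * t) ^ (-(Module.finrank ℝ E : ℝ) / 2) =
      2 ^ ((Module.finrank ℝ E : ℝ) / 2) * (4 * π * (2 * t)) ^ (-(Module.finrank ℝ E : ℝ) / 2) := by
    rw [h0, ← mul_assoc, ← Real.rpow_add (by norm_num : (0:ℝ) < 2),
      show (Module.finrank ℝ E : ℝ) / 2 + -(Module.finrank ℝ E : ℝ) / 2 = 0 by ring,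
      Real.rpow_zero, one_mul]
  have h2 : Real.exp (-‖y‖ ^ 2 / (4 * t)) ≤
      Real.exp (-δ ^ 2 / (8 * t)) * Real.exp (-‖y‖ ^ 2 / (4 * (2 * t))) := by
    rw [← Real.exp_add, Real.exp_le_exp]
    have hsq : δ ^ 2 ≤ ‖y‖ ^ 2 := pow_le_pow_left₀ hδ hy 2
    have h8t : 0 < 8 * t := by positivity
    have key : -‖y‖ ^ 2 / (4 * t) = -‖y‖ ^ 2 / (8 * t) + -‖y‖ ^ 2 / (8 * t) := by
      field_simp
      ring
    rw [key, show (4 * (2 * t)) = 8 * t by ring]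
    gcongr ?_ + _
    exact div_le_div_of_nonneg_right (neg_le_neg hsq) h8t.le
  calc (4 * π * t) ^ (-(Module.finrank ℝ E : ℝ) / 2) * Real.exp (-‖y‖ ^ 2 / (4 * t))
      = 2 ^ ((Module.finrank ℝ E : ℝ) / 2) * (4 * π * (2 * t)) ^ (-(Module.finrank ℝ E : ℝ) / 2) *
          Real.exp (-‖y‖ ^ 2 / (4 * t)) := by rw [h1]
    _ ≤ 2 ^ ((Module.finrank ℝ E : ℝ) / 2) * (4 * π * (2 * t)) ^ (-(Module.finrank ℝ E : ℝ) / 2) *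
          (Real.exp (-δ ^ 2 / (8 * t)) * Real.exp (-‖y‖ ^ 2 / (4 * (2 * t)))) := by
        gcongr
    _ = _ := by ring

variable [FiniteDimensional ℝ E] [MeasurableSpace E] [BorelSpace E]

/-- Gaussian tail estimate: `∫_{‖y‖ ≥ δ} heatKernel t y dy ≤ 2^{n/2} exp(-δ²/(8t))` for `0 < t`,
`0 ≤ δ` (compare with `heatKernel (2t)`, which has mass one). [folklore] -/
theorem setLIntegral_enorm_heatKernel_le {t δ : ℝ} (ht : 0 < t) (hδ : 0 ≤ δ) :
    ∫⁻ y in {y : E | δ ≤ ‖y‖}, ‖heatKernel t y‖ₑ ≤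
      ENNReal.ofReal (2 ^ ((Module.finrank ℝ E : ℝ) / 2) * Real.exp (-δ ^ 2 / (8 * t))) := by
  have hC : 0 ≤ 2 ^ ((Module.finrank ℝ E : ℝ) / 2) * Real.exp (-δ ^ 2 / (8 * t)) := by positivity
  have hS : MeasurableSet {y : E | δ ≤ ‖y‖} :=
    (isClosed_le continuous_const continuous_norm).measurableSet
  calc ∫⁻ y in {y : E | δ ≤ ‖y‖}, ‖heatKernel t y‖ₑ
      ≤ ∫⁻ y in {y : E | δ ≤ ‖y‖}, ENNReal.ofReal (2 ^ ((Module.finrank ℝ E : ℝ) / 2) *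
          Real.exp (-δ ^ 2 / (8 * t))) * ‖heatKernel (2 * t) y‖ₑ := by
        refine setLIntegral_mono' hS fun y hy => ?_
        rw [Real.enorm_of_nonneg (heatKernel_pos ht y).le,
          Real.enorm_of_nonneg (heatKernel_pos (by positivity) y).le, ← ENNReal.ofReal_mul hC]
        exact ENNReal.ofReal_le_ofReal (heatKernel_le_mul_heatKernel_two_mul ht hδ hy)
    _ ≤ ∫⁻ y, ENNReal.ofReal (2 ^ ((Module.finrank ℝ E : ℝ) / 2) *
          Real.exp (-δ ^ 2 / (8 * t))) * ‖heatKernel (2 * t) y‖ₑ := setLIntegral_le_lintegral _ _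
    _ = _ := by
        rw [lintegral_const_mul' _ _ ENNReal.ofReal_ne_top,
          lintegral_enorm_heatKernel (by positivity), mul_one]

/-- The Gauss–Weierstrass kernels concentrate at the origin as `t → 0⁺`: if `Ψ ≤ M < ∞` and
`Ψ y → 0` as `y → 0`, then `∫ heatKernel t y · Ψ y dy → 0` as `t → 0⁺` (split at `‖y‖ = δ`:
mass one near the origin, Gaussian tail away from it). [folklore] -/
theorem tendsto_lintegral_heatKernel_mul {Ψ : E → ℝ≥0∞} {M : ℝ≥0∞} (hM : M ≠ ∞)
    (hΨM : ∀ y, Ψ y ≤ M) (hΨ0 : Tendsto Ψ (𝓝 0) (𝓝 0)) :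
    Tendsto (fun t : ℝ => ∫⁻ y, ‖heatKernel t y‖ₑ * Ψ y) (𝓝[>] 0) (𝓝 0) := by
  rw [ENNReal.tendsto_nhds_zero]
  intro ε hε
  have hε2 : 0 < ε / 2 := ENNReal.half_pos hε.ne'
  -- `Ψ ≤ ε/2` on a ball around the origin
  obtain ⟨δ, hδ, hΨδ⟩ : ∃ δ > 0, ∀ ⦃y : E⦄, ‖y‖ < δ → Ψ y ≤ ε / 2 := by
    have h := Metric.eventually_nhds_iff.1 (ENNReal.tendsto_nhds_zero.1 hΨ0 (ε / 2) hε2)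
    simpa only [dist_zero_right] using h
  -- the Gaussian tail beyond `δ` tends to zero
  have htail : Tendsto (fun t : ℝ => M * ENNReal.ofReal (2 ^ ((Module.finrank ℝ E : ℝ) / 2) *
      Real.exp (-δ ^ 2 / (8 * t)))) (𝓝[>] 0) (𝓝 0) := by
    have h1 : Tendsto (fun t : ℝ => -δ ^ 2 / 8 * t⁻¹) (𝓝[>] 0) atBot :=
      tendsto_inv_nhdsGT_zero.const_mul_atTop_of_neg (by nlinarith [pow_pos hδ 2])
    have h2 : Tendsto (fun t : ℝ => 2 ^ ((Module.finrank ℝ E : ℝ) / 2) *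
        Real.exp (-δ ^ 2 / (8 * t))) (𝓝[>] 0) (𝓝 (2 ^ ((Module.finrank ℝ E : ℝ) / 2) * 0)) := by
      refine Tendsto.const_mul _ ?_
      have h3 := Real.tendsto_exp_atBot.comp h1
      refine h3.congr fun t => ?_
      simp only [Function.comp_apply]
      congr 1
      ring
    rw [mul_zero] at h2
    have h4 := ENNReal.Tendsto.const_mul (ENNReal.tendsto_ofReal h2) (Or.inr hM)
    rwa [ENNReal.ofReal_zero, mul_zero] at h4
  filter_upwards [ENNReal.tendsto_nhds_zero.1 htail (ε / 2) hε2, self_mem_nhdsWithin]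
    with t ht ht0
  replace ht0 : 0 < t := ht0
  have hS : MeasurableSet {y : E | δ ≤ ‖y‖} :=
    (isClosed_le continuous_const continuous_norm).measurableSet
  have hKm : Measurable fun y : E => ‖heatKernel t y‖ₑ := (continuous_heatKernel t).measurable.enorm
  -- pointwise splitting of the integrand
  have hsplit : ∀ y, ‖heatKernel t y‖ₑ * Ψ y ≤ ‖heatKernel t y‖ₑ * (ε / 2) +
      M * {y : E | δ ≤ ‖y‖}.indicator (fun y => ‖heatKernel t y‖ₑ) y := by
    intro y
    by_cases hy : δ ≤ ‖y‖
    · rw [Set.indicator_of_mem (show y ∈ {y : E | δ ≤ ‖y‖} from hy)]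
      calc ‖heatKernel t y‖ₑ * Ψ y ≤ ‖heatKernel t y‖ₑ * M := by gcongr; exact hΨM y
        _ = M * ‖heatKernel t y‖ₑ := mul_comm _ _
        _ ≤ _ := le_add_self
    · rw [Set.indicator_of_notMem (show y ∉ {y : E | δ ≤ ‖y‖} from hy), mul_zero, add_zero]
      gcongr
      exact hΨδ (not_le.1 hy)
  calc ∫⁻ y, ‖heatKernel t y‖ₑ * Ψ y
      ≤ ∫⁻ y, (‖heatKernel t y‖ₑ * (ε / 2) +
          M * {y : E | δ ≤ ‖y‖}.indicator (fun y => ‖heatKernel t y‖ₑ) y) := lintegral_mono hsplit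
    _ = (∫⁻ y, ‖heatKernel t y‖ₑ) * (ε / 2) + M * ∫⁻ y in {y : E | δ ≤ ‖y‖}, ‖heatKernel t y‖ₑ := by
        rw [lintegral_add_left (hKm.mul_const _), lintegral_mul_const _ hKm,
          lintegral_const_mul _ (hKm.indicator hS), lintegral_indicator hS]
    _ ≤ 1 * (ε / 2) + M * ENNReal.ofReal (2 ^ ((Module.finrank ℝ E : ℝ) / 2) *
          Real.exp (-δ ^ 2 / (8 * t))) := by
        gcongr
        · exact (lintegral_enorm_heatKernel ht0).le
        · exact setLIntegral_enorm_heatKernel_le ht0 hδ.le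
    _ ≤ ε / 2 + ε / 2 := by rw [one_mul]; gcongr
    _ = ε := ENNReal.add_halves ε

end HeatTail

section StrongContinuity

variable {E : Type*} [NormedAddCommGroup E] [InnerProductSpace ℝ E] [FiniteDimensional ℝ E]
  [MeasurableSpace E] [BorelSpace E] {F : Type*} [NormedAddCommGroup F] [NormedSpace ℝ F]

/-- Discharge of `tendsto_heatExtension_nhdsWithin_zero`: strong continuity of the heat
semigroup on `L^p`, `1 ≤ p < ∞`: `‖e^{tΔ} f - f‖_p → 0` as `t → 0⁺`.
This is Stein, *Singular Integrals*, Ch. III §2.2, Theorem 2 (c) (`‖f ⋆ φ_ε - f‖_p → 0` for an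
approximation of the identity `φ_ε(x) = ε^{-n} φ(x/ε)`, `∫ φ = 1`), specialised to the
Gauss–Weierstrass kernel `heatKernel t = φ_{√t}`, `φ = heatKernel 1`. Proof as printed there:
continuity of translations `Δ(y) = ‖f(· - y) - f‖_p → 0` (`tendsto_eLpNorm_comp_sub_right_sub`),
the identity `K_t ⋆ f - f = ∫ K_t(y) [f(· - y) - f] dy` (mass one), and concentration of the
kernels at the origin; Minkowski's integral inequality is replaced by the Jensen–Tonelli bound
`‖K_t ⋆ f - f‖_p^p ≤ ∫ K_t(y) Δ(y)^p dy` (`lintegral_rpow_enorm_convolution_sub_self_le`) and the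
dominated-convergence step by the explicit Gaussian tail bound `setLIntegral_enorm_heatKernel_le`.
Evans, *PDE*, §2.3.1, Theorem 1 (iii) is the pointwise analogue.
[cite: SteinSingularIntegrals1970, Ch. III §2.2 Theorem 2(c)] -/
theorem tendsto_heatExtension_nhdsWithin_zero_holds :
    tendsto_heatExtension_nhdsWithin_zero (E := E) (F := F) := by
  intro _ f p hf hp hptop
  have hp0 : p ≠ 0 := (zero_lt_one.trans_le hp).ne'
  have hp' : 1 ≤ p.toReal := by
    simpa using (ENNReal.toReal_le_toReal ENNReal.one_ne_top hptop).2 hp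
  have hp0' : 0 < p.toReal := one_pos.trans_le hp'
  -- `Δ(y) = ‖f(· - y) - f‖_p`, its limit at `0` and its uniform bound
  have hΦ0 : Tendsto (fun y : E => eLpNorm (fun x => f (x - y) - f x) p volume) (𝓝 0) (𝓝 0) :=
    tendsto_eLpNorm_comp_sub_right_sub hf hp hptop
  have hΦM : ∀ y : E, eLpNorm (fun x => f (x - y) - f x) p volume ≤ 2 * eLpNorm f p volume := by
    intro y
    have hfy : AEStronglyMeasurable (fun x => f (x - y)) volume :=
      hf.aestronglyMeasurable.comp_quasiMeasurePreserving
        (measurePreserving_sub_right volume y).quasiMeasurePreserving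
    have hy := eLpNorm_comp_measurePreserving (p := p) hf.aestronglyMeasurable
      (measurePreserving_sub_right volume y)
    simp only [Function.comp_def] at hy
    calc eLpNorm (fun x => f (x - y) - f x) p volume
        ≤ eLpNorm (fun x => f (x - y)) p volume + eLpNorm f p volume :=
          eLpNorm_sub_le hfy hf.aestronglyMeasurable hp
      _ = 2 * eLpNorm f p volume := by rw [hy, two_mul]
  -- `Ψ = Δ^p`
  have hΨ0 : Tendsto (fun y : E => eLpNorm (fun x => f (x - y) - f x) p volume ^ p.toReal)
      (𝓝 0) (𝓝 0) := by
    have h := ((ENNReal.continuous_rpow_const (y := p.toReal)).tendsto 0).comp hΦ0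
    rwa [ENNReal.zero_rpow_of_pos hp0'] at h
  have hΨM : ∀ y : E, eLpNorm (fun x => f (x - y) - f x) p volume ^ p.toReal ≤
      (2 * eLpNorm f p volume) ^ p.toReal := fun y => ENNReal.rpow_le_rpow (hΦM y) hp0'.le
  have hM : (2 * eLpNorm f p volume) ^ p.toReal ≠ ∞ :=
    ENNReal.rpow_ne_top_of_nonneg hp0'.le (ENNReal.mul_ne_top ENNReal.ofNat_ne_top hf.eLpNorm_ne_top)
  have hlim := tendsto_lintegral_heatKernel_mul hM hΨM hΨ0
  -- the bound `‖e^{tΔ} f - f‖_p ≤ (∫ K_t(y) Δ(y)^p dy)^{1/p}` for `0 < t`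
  have hbound : ∀ t : ℝ, 0 < t → eLpNorm (heatExtension f t - f) p volume ≤
      (∫⁻ y, ‖heatKernel t y‖ₑ * eLpNorm (fun x => f (x - y) - f x) p volume ^ p.toReal) ^
        (1 / p.toReal) := by
    intro t ht
    haveI : p.HolderConjugate (ENNReal.conjExponent p) := .conjExponent hp
    have hq : 1 ≤ ENNReal.conjExponent p :=
      ENNReal.HolderConjugate.one_le (ENNReal.conjExponent p) p
    rw [eLpNorm_eq_lintegral_rpow_enorm_toReal hp0 hptop]
    refine ENNReal.rpow_le_rpow ?_ (by positivity)
    have h := lintegral_rpow_enorm_convolution_sub_self_le (μ := volume)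
      (integrable_heatKernel_holds ht) (integral_heatKernel_eq_one_holds ht)
      hf.aestronglyMeasurable (Eventually.of_forall fun x =>
        convolutionExistsAt_of_memLp _ (memLp_heatKernel ht hq) hf x) hp'
    rw [lintegral_enorm_heatKernel ht, ENNReal.one_rpow, one_mul] at h
    simp only [Pi.sub_apply, heatExtension]
    refine h.trans_eq (lintegral_congr fun y => ?_)
    rw [eLpNorm_eq_lintegral_rpow_enorm_toReal hp0 hptop, ← ENNReal.rpow_mul,
      one_div_mul_cancel hp0'.ne', ENNReal.rpow_one]
  -- squeeze
  have hlim' : Tendsto (fun t : ℝ => (∫⁻ y, ‖heatKernel t y‖ₑ *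
      eLpNorm (fun x => f (x - y) - f x) p volume ^ p.toReal) ^ (1 / p.toReal)) (𝓝[>] 0) (𝓝 0) := by
    have h := ((ENNReal.continuous_rpow_const (y := 1 / p.toReal)).tendsto 0).comp hlim
    rwa [ENNReal.zero_rpow_of_pos (by positivity)] at h
  refine tendsto_of_tendsto_of_tendsto_of_le_of_le' tendsto_const_nhds hlim'
    (Eventually.of_forall fun _ => zero_le) ?_
  filter_upwards [self_mem_nhdsWithin] with t ht
  exact hbound t ht

end StrongContinuity

end Literature.Analysis.UnboundedOperators
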